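import Summits.CriticalPhenomena.PercolationContinuityZ3.Theorems.PercNearOneGluingNoHeavyLowerTailSahiCombMixFiveSingle
import Summits.CriticalPhenomena.PercolationContinuityZ3.Theorems.PercNearOneGluingNoHeavyLowerTailSahiCombMixFourSlot

/-!
# The comb hierarchy for Sahi's `E_k`, LXI: the order-4 interface of the single-member OR step at `n = 5` from THREE canonical cells
# (`(U_01,U_02,U_3,U_4)`, `(U_01,U_02,U_03,U_4)`, `(U_01,U_02,U_03,U_04)` with `e` OR-ed into `U_0`); the one-touched cell is affine

Support file of the one-cut programme (crux `NoHeavyLowerTail`, stmt-CriticalPhenomena-4575; cell `prim-masterthm`, seat P3, gen 10;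
`run/shared/lean/prim/prim-masterthm/prim-masterthm-p3/HIERARCHY.md` §18(h),(k)).  Continues `…SahiCombMixFiveSingle` (`combHereditary_orCoord_five_single_of_cells`: the
single-member OR step at `n = 5` from the order-4 interface `CombFiveSingleFourSlotCells`).  Here that interface is reduced to the three substantive cells:
for an order-4 slot map `K` let `S = {j : 0 ∈ K_j}` (the touched slots) and `Q_j = ⋂_{l ∈ K_j ∖ 0} W_l`; the row is the row of the DERIVED quintuple
`W′ = (W_0, Q_{touched}, Q_{untouched})` (again `CombHereditary`, `CombHereditary.of_eq_biInter`) over the canonical slots `{0,1},…,{0,k},{k+1},…` up to a slot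
permutation (`sahiE_comp_perm`): `|S| = 0` a plain row, `|S| = 1` the AFFINE cell `(1−p_e)·E_4(W_0W_1,W_2,W_3,W_4) + p_e·E_4(W_1,…,W_4)` (`combPos_four_single_affine`, via the
generic four-slot cell `sahiE_four_mixCoord_eq` / `combPos_four_mixCoord_of_coeffs` of gen 8), `|S| = k ≥ 2` the canonical cell `CombFiveSingleCell k`.
* `CombFiveSingleCell 2/3/4` — the three interfaces (classes 159/173/186 of the gen-8 census; all their Bernstein coefficients are SLSQP-clean on `𝒦_5`; ttrl's her5 LP:
  `q = 1` certificates at L0/L1 except `c_1` of cell 4 = `(U_01,U_02,U_03,U_04)`, requests l.1573/1598; to be lifted from member-moment identities with `mix4C1/2/3`).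
* **`combFiveSingleFourSlotCells_of_cells`** — the three cells give the whole order-4 interface (generated 16-arm dispatcher, seat script `gen/gen_fivesingle.py`).
* **`combHereditary_orCoord_five_single_of_three_cells`** — hence the single-member OR step at `n = 5` from the three cells.
HONEST FRAMING: conditional on the three cells; nothing here asserts (M⁺-k) or `C_k` for `k ≥ 3`. [this work]
-/

noncomputable section

open scoped Classical

namespace Summit.CriticalPhenomena.PercolationContinuityZ3.Theorems

open Finset Function
open Literature.Combinatorics.Sahi2008
open Literature.Probability.Percolation.DecisionTree (ind ind_of_mem ind_of_not_mem ind_nonneg)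
open SahiComb
open SahiCombDisjunct (orCoord)
open SahiCombHereditary (CombHereditary isUpperSet_biInter)

variable {ι : Type} [Fintype ι]

namespace SahiCombMix

/-! ### Canonical slots (touched first) and the three cell interfaces -/

/-- Canonical order-4 slots with `k` touched slots first: `{0,1},…,{0,k},{k+1},…,{4}` (`k = 1,…,4`; index `k − 1`). [this work] -/
def canonSingleK : Fin 4 → Fin 4 → Finset (Fin 5) :=
  ![![{0, 1}, {2}, {3}, {4}], ![{0, 1}, {0, 2}, {3}, {4}], ![{0, 1}, {0, 2}, {0, 3}, {4}], ![{0, 1}, {0, 2}, {0, 3}, {0, 4}]]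

/-- **Interface: the canonical single-member cell with `k + 1` touched slots** (`k = 1, 2, 3`: classes 159, 173, 186) — for every finite cube, every `CombHereditary`
quintuple `W` of increasing events ignoring `e`: `p ↦ E_4(μ_p; ((W_0∪{e∈ω}) ∩ W_1, …, (W_0∪{e∈ω}) ∩ W_{k+1}, W_{k+2}, …, W_4))` is comb-positive at multidegree `4`.  NOT proved
here. [this work] -/
def CombFiveSingleCell (k : Fin 4) : Prop :=
  ∀ (ι : Type) [Fintype ι] (W : Fin 5 → Set (Set ι)) (e : ι), (∀ j, IsUpperSet (W j)) → (∀ (j : Fin 5) (b : Bool), secAt e b (W j) = W j) →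
    CombHereditary W →
      CombPos (fun _ : ι => 4) (fun p => sahiE (bernoulliWeight p) 4 (fun j => ind (⋂ l ∈ canonSingleK k j, orCoord W e (sel 0) l)))

/-! ### Slot algebra -/

omit [Fintype ι] in
/-- A touched slot of `W` over `K ∋ 0` is the canonical touched slot `{0,t}` of any family `W′` with `W′_0 = W_0`, `W′_t = ⋂_{K∖0} W`. [this work] -/
theorem slot_touched (W W' : Fin 5 → Set (Set ι)) (e : ι) (K : Finset (Fin 5)) (hK : (0 : Fin 5) ∈ K) (t : Fin 5) (ht : t ≠ 0)
    (h0 : W' 0 = W 0) (ht' : W' t = ⋂ l ∈ K.erase 0, W l) :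
    (⋂ l ∈ K, orCoord W e (sel 0) l) = ⋂ l ∈ ({0, t} : Finset (Fin 5)), orCoord W' e (sel 0) l := by
  rw [biInter_orCoord_sel W e 0 K, if_pos hK, biInter_orCoord_sel W' e 0 {0, t}, if_pos (Finset.mem_insert_self _ _),
    Finset.erase_insert (by simpa using ht.symm), Finset.set_biInter_singleton, ht', h0]

omit [Fintype ι] in
/-- An untouched slot of `W` over `K ∌ 0` is the canonical untouched slot `{t}` of any family `W′` with `W′_t = ⋂_{K∖0} W`. [this work] -/
theorem slot_untouched (W W' : Fin 5 → Set (Set ι)) (e : ι) (K : Finset (Fin 5)) (hK : (0 : Fin 5) ∉ K) (t : Fin 5) (ht : t ≠ 0)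
    (ht' : W' t = ⋂ l ∈ K.erase 0, W l) :
    (⋂ l ∈ K, orCoord W e (sel 0) l) = ⋂ l ∈ ({t} : Finset (Fin 5)), orCoord W' e (sel 0) l := by
  rw [biInter_orCoord_sel W e 0 K, if_neg hK, Set.inter_univ, Finset.set_biInter_singleton, orCoord_sel_of_ne W' e ht, ht']

/-! ### The one-touched cell is affine -/

section Affine

variable (W : Fin 5 → Set (Set ι)) (e : ι) (hWe : ∀ (j : Fin 5) (b : Bool), secAt e b (W j) = W j)
include hWe

/-- **The one-touched order-4 cell is comb-positive**: `E_4(μ_p; (W_0∪{e∈ω})∩W_1, W_2, W_3, W_4) = (1−p_e)·E_4(W_0W_1,W_2,W_3,W_4) + p_e·E_4(W_1,…,W_4)`, both rows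
comb-positive off `e` (via the generic four-slot cell with `P = (W_0W_1,W_2,W_3,W_4)`, `Q = (W_1,W_2,W_3,W_4)`: `C_1 = 3E_4(P)+E_4(Q)`, `C_2 = 3E_4(P)+3E_4(Q)`,
`C_3 = E_4(P)+3E_4(Q)`). [this work] -/
theorem combPos_four_single_affine (hW : CombHereditary W) :
    CombPos (fun _ : ι => 4) (fun p => sahiE (bernoulliWeight p) 4 (fun j => ind (⋂ l ∈ canonSingleK 0 j, orCoord W e (sel 0) l))) := by
  set P : Fin 4 → Set (Set ι) := fun j => ⋂ l ∈ canonSingleK 0 j, W l with hPdef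
  set Q : Fin 4 → Set (Set ι) := fun j => ⋂ l ∈ (canonSingleK 0 j).filter (fun l => sel (0 : Fin 5) l = false), W l with hQdef
  have eS : (fun j => ind (⋂ l ∈ canonSingleK 0 j, orCoord W e (sel 0) l)) = fun j => ind (mixCoord e (P j) (Q j)) := by
    funext j; rw [biInter_orCoord_eq_mixCoord]
  have hP : ∀ (j : Fin 4) (b : Bool), secAt e b (P j) = P j := fun j b => secAt_biInter W e hWe _ b
  have hQ : ∀ (j : Fin 4) (b : Bool), secAt e b (Q j) = Q j := fun j b => secAt_biInter W e hWe _ b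
  have hPQ : ∀ j : Fin 4, P j ⊆ Q j := fun j => Set.biInter_subset_biInter_left (Finset.filter_subset _ _)
  -- the filtered index sets
  have f0 : (canonSingleK 0 0).filter (fun l => sel (0 : Fin 5) l = false) = {1} := by decide
  have f1 : (canonSingleK 0 1).filter (fun l => sel (0 : Fin 5) l = false) = {2} := by decide
  have f2 : (canonSingleK 0 2).filter (fun l => sel (0 : Fin 5) l = false) = {3} := by decide
  have f3 : (canonSingleK 0 3).filter (fun l => sel (0 : Fin 5) l = false) = {4} := by decide
  have q1 : Q 1 = P 1 := by simp only [hQdef, hPdef, f1]; rfl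
  have q2 : Q 2 = P 2 := by simp only [hQdef, hPdef, f2]; rfl
  have q3 : Q 3 = P 3 := by simp only [hQdef, hPdef, f3]; rfl
  -- the two hereditary rows, off `e`
  have rP := hW.row_off e hWe 4 (canonSingleK 0)
  have rQ := hW.row_off e hWe 4 (fun j => (canonSingleK 0 j).filter (fun l => sel (0 : Fin 5) l = false))
  have ePf : (fun j => ind (⋂ l ∈ canonSingleK 0 j, W l)) = ![ind (P 0), ind (P 1), ind (P 2), ind (P 3)] := by
    funext j; fin_cases j <;> rfl
  have eQf : (fun j => ind (⋂ l ∈ (canonSingleK 0 j).filter (fun l => sel (0 : Fin 5) l = false), W l)) = ![ind (Q 0), ind (Q 1), ind (Q 2), ind (Q 3)] := by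
    funext j; fin_cases j <;> rfl
  rw [ePf] at rP
  rw [eQf] at rQ
  have rPm := rP
  have rQm := rQ
  simp only [sahiE_four] at rPm rQm
  rw [q1, q2, q3] at rQm
  have eP : (fun j => ind (P j)) = ![ind (P 0), ind (P 1), ind (P 2), ind (P 3)] := by funext j; fin_cases j <;> rfl
  have eQ : (fun j => ind (Q j)) = ![ind (Q 0), ind (Q 1), ind (Q 2), ind (Q 3)] := by funext j; fin_cases j <;> rfl
  rw [eS]
  refine combPos_four_mixCoord_of_coeffs e P Q hP hQ hPQ ?_ ?_ ?_ ?_ ?_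
  · rw [eP]; exact rP
  · refine ((rPm.smul (by norm_num : (0:ℝ) ≤ 3)).add (rQm.smul (by norm_num : (0:ℝ) ≤ 1))).congr fun p => ?_
    simp only [mix4C1, q1, q2, q3]
    ring
  · refine ((rPm.smul (by norm_num : (0:ℝ) ≤ 3)).add (rQm.smul (by norm_num : (0:ℝ) ≤ 3))).congr fun p => ?_
    simp only [mix4C2, q1, q2, q3]
    ring
  · refine ((rPm.smul (by norm_num : (0:ℝ) ≤ 1)).add (rQm.smul (by norm_num : (0:ℝ) ≤ 3))).congr fun p => ?_
    simp only [mix4C3, q1, q2, q3]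
    ring
  · rw [eQ]; exact rQ

end Affine

/-! ### Degree bookkeeping -/


omit [Fintype ι] in
/-- The order-4 degree bound `4` dominates the degree off `e`. [folklore] -/
theorem deg_off_le_four (e : ι) : update (fun _ : ι => (4 : ℕ)) e 0 ≤ fun _ : ι => 4 := fun x => by
  by_cases hx : x = e
  · subst hx; simp
  · simp [hx]


end SahiCombMix

end Summit.CriticalPhenomena.PercolationContinuityZ3.Theorems

end
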